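import Mathlib
import Literature.MathematicalPhysics.QuantumLattice.WilsonDiracAP
import Literature.MathematicalPhysics.QuantumLattice.GrassmannIntegralProofs
import HarnessLib

/-!
# The Wilson–Dirac operator in a chiral spin basis (stub `stub_marginalRP` of crux
stmt-QuantumFields-9735, line Sketch — helper file 2)

The site-reflection positivity of the Wilson fermion determinant is a statement about the
CHIRALITY blocks of the `r = 1` Wilson–Dirac matrix with respect to `γ₀` (time = direction `0`).
The tree's `wilsonDirac` uses the basis `γ₀ = σʸ ⊗ σˣ`, `γ₅ = diag(1,1,-1,-1)`; here we pass to
a basis in which `γ₀ = diag(1,1,-1,-1)` and `γ₅ = σˣ ⊗ 1` (the spin flip `sflip`):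

* `wilsonDiracG ρ γ U m r` — the Wilson–Dirac matrix with an arbitrary family of spin matrices
  `γ`; `wilsonDirac ρ U m r = wilsonDiracG ρ euclideanGamma U m r` by `rfl`;
* `chiralGamma` — the transformed matrices `u γ_μ u⁻¹` (`uSpin_mul_gamma`), and
  `det_wilsonDiracG_chiral : det (wilsonDiracG ρ chiralGamma U m r) = det (wilsonDirac ρ U m r)`;
* the entrywise symmetries of `D' = wilsonDiracG ρ chiralGamma`: reflection covariance with the
  phased spin flip (`wilsonDiracG_chiral_reflect`), `γ₅`-hermiticity `conj D'_{q,p} = D'_{flip p, flip q}`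
  (`wilsonDiracG_chiral_conj`), covariance under central gauge transformations
  (`wilsonDiracG_gaugeTransform_central`).
-/

noncomputable section

open Matrix Complex Finset
open Literature.MathematicalPhysics.QuantumLattice Literature.MathematicalPhysics.QuantumFieldTheory
open Literature.Probability.LatticeModels
open scoped ComplexConjugate BigOperators Kronecker

namespace Summit.QuantumFields.QCD.Theorems.UnquenchedChessboardBoundLine

section General

variable {L N : ℕ} [NeZero L] {G : Type*} [Group G] (ρ : G →* Matrix (Fin N) (Fin N) ℂ)

/-! ## The Wilson–Dirac matrix with general spin matrices -/

/-- The Wilson–Dirac matrix with an arbitrary family `γ` of `4 × 4` spin matrices (same formula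
as the tree's `wilsonDirac`, which is the case `γ = euclideanGamma`). -/
def wilsonDiracG (γ : Fin 4 → Matrix (Fin 4) (Fin 4) ℂ) (U : GaugeConfig 4 L G) (m r : ℝ) :
    Matrix (TorusSite 4 L × Fin N × Fin 4) (TorusSite 4 L × Fin N × Fin 4) ℂ :=
  Matrix.of fun p q =>
    (if p = q then ((m + 4 * r : ℝ) : ℂ) else 0) -
      (1 / 2 : ℂ) * ∑ μ : Fin 4,
        ((if q.1 = Site.shift p.1 μ then
            ((r : ℂ) • (1 : Matrix (Fin 4) (Fin 4) ℂ) - γ μ) p.2.2 q.2.2 *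
              ρ (U (p.1, μ)) p.2.1 q.2.1 else 0) +
          (if p.1 = Site.shift q.1 μ then
            ((r : ℂ) • (1 : Matrix (Fin 4) (Fin 4) ℂ) + γ μ) p.2.2 q.2.2 *
              ρ (U (q.1, μ))⁻¹ p.2.1 q.2.1 else 0))

omit [NeZero L] in
/-- The tree's Wilson–Dirac matrix is `wilsonDiracG` with `γ = euclideanGamma`. -/
theorem wilsonDirac_eq_wilsonDiracG (U : GaugeConfig 4 L G) (m r : ℝ) :
    wilsonDirac ρ U m r = wilsonDiracG ρ euclideanGamma U m r := rfl

/-- The `4 × 4` spin kernel of `wilsonDiracG` between the site–colour pairs `(x,a)` and `(y,b)`. -/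
def spinKernel (γ : Fin 4 → Matrix (Fin 4) (Fin 4) ℂ) (U : GaugeConfig 4 L G) (m r : ℝ)
    (x : TorusSite 4 L) (a : Fin N) (y : TorusSite 4 L) (b : Fin N) : Matrix (Fin 4) (Fin 4) ℂ :=
  (if x = y ∧ a = b then ((m + 4 * r : ℝ) : ℂ) else 0) • (1 : Matrix (Fin 4) (Fin 4) ℂ) -
    (1 / 2 : ℂ) • ∑ μ : Fin 4,
      ((if y = Site.shift x μ then ρ (U (x, μ)) a b else 0) •
          ((r : ℂ) • (1 : Matrix (Fin 4) (Fin 4) ℂ) - γ μ) +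
        (if x = Site.shift y μ then ρ (U (y, μ))⁻¹ a b else 0) •
          ((r : ℂ) • (1 : Matrix (Fin 4) (Fin 4) ℂ) + γ μ))

omit [NeZero L] in
/-- Entries of `wilsonDiracG` through the spin kernel. -/
theorem wilsonDiracG_apply (γ : Fin 4 → Matrix (Fin 4) (Fin 4) ℂ) (U : GaugeConfig 4 L G) (m r : ℝ)
    (p q : TorusSite 4 L × Fin N × Fin 4) :
    wilsonDiracG ρ γ U m r p q = spinKernel ρ γ U m r p.1 p.2.1 q.1 q.2.1 p.2.2 q.2.2 := by
  obtain ⟨x, a, α⟩ := p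
  obtain ⟨y, b, β⟩ := q
  simp only [wilsonDiracG, spinKernel, Matrix.of_apply, Matrix.sub_apply, Matrix.smul_apply,
    Matrix.sum_apply, Matrix.add_apply, smul_eq_mul, Prod.mk.injEq]
  congr 1
  · by_cases h : x = y ∧ a = b
    · obtain ⟨rfl, rfl⟩ := h
      simp [Matrix.one_apply]
    · rw [if_neg h, if_neg (fun h' => h ⟨h'.1, h'.2.1⟩), zero_mul]
  · congr 1
    refine Finset.sum_congr rfl fun μ _ => ?_
    congr 1
    · split_ifs <;> ring
    · split_ifs <;> ring

/-! ## The spinor lift algebra -/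

/-- Left multiplication by a spinor lift acts on the spin index only. -/
theorem spinorLift_mul_apply (Γ : Matrix (Fin 4) (Fin 4) ℂ)
    (M : Matrix (TorusSite 4 L × Fin N × Fin 4) (TorusSite 4 L × Fin N × Fin 4) ℂ)
    (p q : TorusSite 4 L × Fin N × Fin 4) :
    (spinorLift (L := L) (N := N) Γ * M) p q = ∑ α, Γ p.2.2 α * M (p.1, p.2.1, α) q := by
  rw [Matrix.mul_apply, Fintype.sum_prod_type, Finset.sum_eq_single p.1, Fintype.sum_prod_type,
    Finset.sum_eq_single p.2.1]
  · simp [spinorLift, Matrix.kroneckerMap_apply]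
  · exact fun b _ hb => by simp [spinorLift, Matrix.kroneckerMap_apply, hb.symm]
  · simp
  · exact fun x _ hx => by simp [spinorLift, Matrix.kroneckerMap_apply, Matrix.one_apply, hx.symm]
  · simp

/-- Right multiplication by a spinor lift acts on the spin index only. -/
theorem mul_spinorLift_apply (Γ : Matrix (Fin 4) (Fin 4) ℂ)
    (M : Matrix (TorusSite 4 L × Fin N × Fin 4) (TorusSite 4 L × Fin N × Fin 4) ℂ)
    (p q : TorusSite 4 L × Fin N × Fin 4) :
    (M * spinorLift (L := L) (N := N) Γ) p q = ∑ β, M p (q.1, q.2.1, β) * Γ β q.2.2 := by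
  rw [Matrix.mul_apply, Fintype.sum_prod_type, Finset.sum_eq_single q.1, Fintype.sum_prod_type,
    Finset.sum_eq_single q.2.1]
  · simp [spinorLift, Matrix.kroneckerMap_apply]
  · exact fun b _ hb => by simp [spinorLift, Matrix.kroneckerMap_apply, hb]
  · simp
  · exact fun x _ hx => by simp [spinorLift, Matrix.kroneckerMap_apply, Matrix.one_apply, hx]
  · simp

/-- Spinor lifts multiply. -/
theorem spinorLift_mul_spinorLift (A B : Matrix (Fin 4) (Fin 4) ℂ) :
    spinorLift (L := L) (N := N) A * spinorLift (L := L) (N := N) B =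
      spinorLift (L := L) (N := N) (A * B) := by
  simp only [spinorLift, ← Matrix.mul_kronecker_mul, Matrix.mul_one]

/-- Conjugating `wilsonDiracG` by a spinor lift changes the spin matrices: if `u γ_μ = γ'_μ u`
then `𝒰 D_γ = D_{γ'} 𝒰`. -/
theorem spinorLift_mul_wilsonDiracG {γ γ' : Fin 4 → Matrix (Fin 4) (Fin 4) ℂ}
    {u : Matrix (Fin 4) (Fin 4) ℂ} (hγ : ∀ μ, u * γ μ = γ' μ * u) (U : GaugeConfig 4 L G) (m r : ℝ) :
    spinorLift (L := L) (N := N) u * wilsonDiracG ρ γ U m r =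
      wilsonDiracG ρ γ' U m r * spinorLift (L := L) (N := N) u := by
  have hker : ∀ x a y b, u * spinKernel ρ γ U m r x a y b = spinKernel ρ γ' U m r x a y b * u := by
    intro x a y b
    simp only [spinKernel, Matrix.mul_sub, Matrix.sub_mul, Matrix.mul_smul, Matrix.smul_mul,
      Matrix.mul_one, Matrix.one_mul, Matrix.mul_sum, Matrix.sum_mul, Matrix.mul_add,
      Matrix.add_mul, hγ]
  ext p q
  rw [spinorLift_mul_apply, mul_spinorLift_apply]
  simp_rw [wilsonDiracG_apply]
  have := congrFun (congrFun (hker p.1 p.2.1 q.1 q.2.1) p.2.2) q.2.2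
  simpa only [Matrix.mul_apply] using this

/-! ## The chiral basis -/

/-- The Euclidean `γ`-matrices in a `γ₀`-diagonal (chiral-in-time) basis:
`γ₀ = diag(1,1,-1,-1)`, and `γ₅ = σˣ ⊗ 1` exchanges the two chirality blocks. -/
def chiralGamma : Fin 4 → Matrix (Fin 4) (Fin 4) ℂ :=
  ![!![1, 0, 0, 0; 0, 1, 0, 0; 0, 0, -1, 0; 0, 0, 0, -1],
    !![0, 0, I, 0; 0, 0, 0, -I; -I, 0, 0, 0; 0, I, 0, 0],
    !![0, 0, 0, -1; 0, 0, 1, 0; 0, 1, 0, 0; -1, 0, 0, 0],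
    !![0, 0, 0, -I; 0, 0, -I, 0; 0, I, 0, 0; I, 0, 0, 0]]

/-- The (unnormalised) change of basis: rows are `√2` times the dual chiral basis vectors. -/
def uSpin : Matrix (Fin 4) (Fin 4) ℂ := !![1, 0, 0, -I; 0, 1, -I, 0; 1, 0, 0, I; 0, 1, I, 0]

/-- The inverse of `uSpin` (`= uSpinᴴ / 2`). -/
def uInv : Matrix (Fin 4) (Fin 4) ℂ :=
  (1 / 2 : ℂ) • !![1, 0, 1, 0; 0, 1, 0, 1; 0, I, 0, -I; I, 0, -I, 0]

/-- `uSpin · uInv = 1`. -/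
theorem uSpin_mul_uInv : uSpin * uInv = 1 := by
  ext i j
  fin_cases i <;> fin_cases j <;>
    simp [uSpin, uInv, Matrix.mul_apply, Fin.sum_univ_four, Complex.ext_iff] <;> norm_num

/-- `uSpin γ_μ = γ'_μ uSpin`: the chiral matrices are the conjugates of the tree's. -/
theorem uSpin_mul_gamma (μ : Fin 4) : uSpin * euclideanGamma μ = chiralGamma μ * uSpin := by
  ext i j
  fin_cases μ <;> fin_cases i <;> fin_cases j <;>
    simp [uSpin, chiralGamma, Matrix.mul_apply, Fin.sum_univ_four, euclideanGamma,
      spinHalfPauli, Matrix.kroneckerMap_apply, finProdFinEquiv, Fin.divNat, Fin.modNat]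

/-! ## Spin tables in the chiral basis -/

/-- The phases of the reflection spin map `F' = σʸ ⊗ 1` (row `α` has entry `chi α` at column
`sflip α`). -/
def chi : Fin 4 → ℂ := ![-I, -I, I, I]

/-- The chirality flip `γ₅' = σˣ ⊗ 1` on spin indices. -/
def sflip : Fin 4 → Fin 4 := ![2, 3, 0, 1]

/-- `sflip` is an involution. -/
theorem sflip_sflip (α : Fin 4) : sflip (sflip α) = α := by
  fin_cases α <;> rfl

/-- `|chi α|² = 1`. -/
theorem chi_mul_conj (α : Fin 4) : chi α * conj (chi α) = 1 := by
  fin_cases α <;> simp [chi]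

/-- Reflection table for `r - γ'_μ`: the phased spin flip turns it into `r + γ'_0` for `μ = 0`
and leaves it unchanged for spatial `μ`. -/
theorem projMinus_flip (r : ℝ) (μ α β : Fin 4) :
    chi α * conj (chi β) *
        (((r : ℂ) • (1 : Matrix (Fin 4) (Fin 4) ℂ) - chiralGamma μ) (sflip α) (sflip β)) =
      if μ = 0 then ((r : ℂ) • (1 : Matrix (Fin 4) (Fin 4) ℂ) + chiralGamma μ) α β
      else ((r : ℂ) • (1 : Matrix (Fin 4) (Fin 4) ℂ) - chiralGamma μ) α β := by
  fin_cases μ <;> fin_cases α <;> fin_cases β <;>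
    simp [chi, sflip, chiralGamma] <;> ring_nf

/-- Reflection table for `r + γ'_μ`. -/
theorem projPlus_flip (r : ℝ) (μ α β : Fin 4) :
    chi α * conj (chi β) *
        (((r : ℂ) • (1 : Matrix (Fin 4) (Fin 4) ℂ) + chiralGamma μ) (sflip α) (sflip β)) =
      if μ = 0 then ((r : ℂ) • (1 : Matrix (Fin 4) (Fin 4) ℂ) - chiralGamma μ) α β
      else ((r : ℂ) • (1 : Matrix (Fin 4) (Fin 4) ℂ) + chiralGamma μ) α β := by
  fin_cases μ <;> fin_cases α <;> fin_cases β <;>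
    simp [chi, sflip, chiralGamma] <;> ring_nf

/-- `γ₅` table for `r - γ'_μ`: `conj (r - γ'_μ)_{βα} = (r + γ'_μ)_{flip α, flip β}`. -/
theorem conj_projMinus (r : ℝ) (μ α β : Fin 4) :
    conj ((((r : ℂ) • (1 : Matrix (Fin 4) (Fin 4) ℂ) - chiralGamma μ) β α)) =
      ((r : ℂ) • (1 : Matrix (Fin 4) (Fin 4) ℂ) + chiralGamma μ) (sflip α) (sflip β) := by
  fin_cases μ <;> fin_cases α <;> fin_cases β <;> simp [sflip, chiralGamma] <;> ring

/-- `γ₅` table for `r + γ'_μ`. -/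
theorem conj_projPlus (r : ℝ) (μ α β : Fin 4) :
    conj ((((r : ℂ) • (1 : Matrix (Fin 4) (Fin 4) ℂ) + chiralGamma μ) β α)) =
      ((r : ℂ) • (1 : Matrix (Fin 4) (Fin 4) ℂ) - chiralGamma μ) (sflip α) (sflip β) := by
  fin_cases μ <;> fin_cases α <;> fin_cases β <;> simp [sflip, chiralGamma] <;> ring

/-! ## Reflection covariance, `γ₅`-hermiticity, central gauge covariance -/

/-- Algebra of the entrywise proofs: scaling the diagonal and every hopping term by `c`. -/
theorem entry_scale_eq (D D' c : ℂ) (f g : Fin 4 → ℂ) (h1 : D = c * D') (h2 : ∀ μ, f μ = c * g μ) :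
    D - (1 / 2 : ℂ) * ∑ μ, f μ = c * (D' - (1 / 2 : ℂ) * ∑ μ, g μ) := by
  rw [h1, mul_sub, Finset.mul_sum, Finset.mul_sum, Finset.mul_sum]
  congr 1
  refine Finset.sum_congr rfl fun μ _ => ?_
  rw [h2]
  ring

/-- Algebra of the entrywise proofs: conjugating the diagonal and every hopping term. -/
theorem entry_conj_eq (D D' : ℂ) (f g : Fin 4 → ℂ) (h1 : conj D = D') (h2 : ∀ μ, conj (f μ) = g μ) :
    conj (D - (1 / 2 : ℂ) * ∑ μ, f μ) = D' - (1 / 2 : ℂ) * ∑ μ, g μ := by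
  rw [map_sub, map_mul, map_sum, h1, map_div₀, map_one, map_ofNat]
  congr 1
  congr 1
  exact Finset.sum_congr rfl fun μ _ => h2 μ

/-- The index map of the site reflection in the chiral basis: sites by `θ`, colours fixed, spins
flipped. -/
def chiralReflectIndex (θ : TorusSite 4 L → TorusSite 4 L) (p : TorusSite 4 L × Fin N × Fin 4) :
    TorusSite 4 L × Fin N × Fin 4 :=
  (θ p.1, p.2.1, sflip p.2.2)

/-- `sflip` is injective. -/
theorem sflip_injective : Function.Injective sflip := fun i j h => by
  rw [← sflip_sflip i, h, sflip_sflip]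

omit [NeZero L] in
/-- **Reflection covariance in the chiral basis.** For an involution `θ` of the sites reversing the
time shift and commuting with the spatial ones, and the reflected field `V` of `U`
(`V(x,0) = U(θ(x+ê₀),0)⁻¹`, `V(x,k) = U(θx,k)`):
`D'[V]_{p,q} = χ(α_p) conj χ(α_q) · D'[U]_{Rp, Rq}` with `R = chiralReflectIndex θ`. -/
theorem wilsonDiracG_chiral_reflect (θ : TorusSite 4 L → TorusSite 4 L) (hθ : Function.Involutive θ)
    (hθ0 : ∀ x y, θ x = Site.shift (θ y) 0 ↔ y = Site.shift x 0)
    (hθk : ∀ x (k : Fin 4), k ≠ 0 → θ (Site.shift x k) = Site.shift (θ x) k)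
    (U V : GaugeConfig 4 L G) (hV0 : ∀ x, V (x, 0) = (U (θ (Site.shift x 0), 0))⁻¹)
    (hVk : ∀ x k, k ≠ 0 → V (x, k) = U (θ x, k)) (m r : ℝ) (p q : TorusSite 4 L × Fin N × Fin 4) :
    wilsonDiracG ρ chiralGamma V m r p q =
      chi p.2.2 * conj (chi q.2.2) *
        wilsonDiracG ρ chiralGamma U m r (chiralReflectIndex θ p) (chiralReflectIndex θ q) := by
  obtain ⟨x, a, α⟩ := p
  obtain ⟨y, b, β⟩ := q
  simp only [chiralReflectIndex, wilsonDiracG, Matrix.of_apply]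
  refine entry_scale_eq _ _ _ _ _ ?_ (fun μ => ?_)
  · by_cases h : ((x, a, α) : TorusSite 4 L × Fin N × Fin 4) = (y, b, β)
    · simp only [Prod.mk.injEq] at h
      obtain ⟨rfl, rfl, rfl⟩ := h
      rw [if_pos rfl, if_pos rfl, chi_mul_conj, one_mul]
    · have h' : ¬ ((θ x, a, sflip α) : TorusSite 4 L × Fin N × Fin 4) = (θ y, b, sflip β) := by
        simpa only [Prod.mk.injEq, hθ.injective.eq_iff, sflip_injective.eq_iff] using h
      rw [if_neg h, if_neg h', mul_zero]
  · rw [mul_add]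
    by_cases hμ : μ = 0
    · subst hμ
      rw [add_comm]
      congr 1
      · simp only [hθ0 y x]
        split_ifs with h
        · subst h
          rw [← mul_assoc, projMinus_flip, if_pos rfl, hV0, inv_inv]
        · rw [mul_zero]
      · simp only [hθ0 x y]
        split_ifs with h
        · subst h
          rw [← mul_assoc, projPlus_flip, if_pos rfl, hV0]
        · rw [mul_zero]
    · have h1 : θ y = Site.shift (θ x) μ ↔ y = Site.shift x μ := by
        rw [← hθk x μ hμ, hθ.injective.eq_iff]
      have h2 : θ x = Site.shift (θ y) μ ↔ x = Site.shift y μ := by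
        rw [← hθk y μ hμ, hθ.injective.eq_iff]
      simp only [h1, h2]
      congr 1
      · split_ifs with h
        · rw [← mul_assoc, projMinus_flip, if_neg hμ, hVk x μ hμ]
        · rw [mul_zero]
      · split_ifs with h
        · rw [← mul_assoc, projPlus_flip, if_neg hμ, hVk y μ hμ]
        · rw [mul_zero]

omit [NeZero L] in
/-- **`γ₅`-hermiticity in the chiral basis**: for unitary-valued `ρ`,
`conj D'_{q,p} = D'_{(x_p, a_p, flip α_p), (x_q, a_q, flip α_q)}`. -/
theorem wilsonDiracG_chiral_conj (hρ : ∀ g, ρ g ∈ Matrix.unitaryGroup (Fin N) ℂ)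
    (U : GaugeConfig 4 L G) (m r : ℝ) (p q : TorusSite 4 L × Fin N × Fin 4) :
    conj (wilsonDiracG ρ chiralGamma U m r q p) =
      wilsonDiracG ρ chiralGamma U m r (p.1, p.2.1, sflip p.2.2) (q.1, q.2.1, sflip q.2.2) := by
  obtain ⟨x, a, α⟩ := p
  obtain ⟨y, b, β⟩ := q
  have hsi : ∀ (g : G) (a b : Fin N), conj (ρ g⁻¹ b a) = ρ g a b := fun g a b =>
    unitaryRep_star_inv_apply ρ hρ g a b
  have hs : ∀ (g : G) (a b : Fin N), conj (ρ g b a) = ρ g⁻¹ a b := fun g a b =>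
    unitaryRep_star_apply ρ hρ g a b
  simp only [wilsonDiracG, Matrix.of_apply]
  refine entry_conj_eq _ _ _ _ ?_ (fun μ => ?_)
  · by_cases h : ((y, b, β) : TorusSite 4 L × Fin N × Fin 4) = (x, a, α)
    · simp only [Prod.mk.injEq] at h
      obtain ⟨rfl, rfl, rfl⟩ := h
      rw [if_pos rfl, if_pos rfl, Complex.conj_ofReal]
    · have h' : ¬ ((x, a, sflip α) : TorusSite 4 L × Fin N × Fin 4) = (y, b, sflip β) := by
        intro h'
        simp only [Prod.mk.injEq, sflip_injective.eq_iff] at h'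
        exact h (by rw [h'.1, h'.2.1, h'.2.2])
      rw [if_neg h, if_neg h', map_zero]
  · rw [map_add, add_comm]
    congr 1
    · split_ifs with h
      · rw [map_mul, conj_projPlus, hsi]
      · exact map_zero _
    · split_ifs with h
      · rw [map_mul, conj_projMinus, hs]
      · exact map_zero _

omit [NeZero L] in
/-- **Central gauge covariance**: if `ρ(g x) = ε(x) · 1` with `ε(x)² = 1`, then
`D_γ[U^g]_{p,q} = ε(x_p) ε(x_q) D_γ[U]_{p,q}`. -/
theorem wilsonDiracG_gaugeTransform_central (γ : Fin 4 → Matrix (Fin 4) (Fin 4) ℂ)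
    (g : TorusSite 4 L → G) (ε : TorusSite 4 L → ℂ) (hg : ∀ x, ρ (g x) = ε x • (1 : Matrix _ _ ℂ))
    (hε : ∀ x, ε x * ε x = 1) (U : GaugeConfig 4 L G) (m r : ℝ)
    (p q : TorusSite 4 L × Fin N × Fin 4) :
    wilsonDiracG ρ γ (gaugeTransform g U) m r p q = ε p.1 * ε q.1 * wilsonDiracG ρ γ U m r p q := by
  obtain ⟨x, a, α⟩ := p
  obtain ⟨y, b, β⟩ := q
  have hginv : ∀ z, ρ (g z)⁻¹ = ε z • (1 : Matrix (Fin N) (Fin N) ℂ) := by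
    intro z
    have h1 : ρ (g z)⁻¹ * ρ (g z) = 1 := by rw [← map_mul, inv_mul_cancel, map_one]
    have h2 : (ε z • (1 : Matrix (Fin N) (Fin N) ℂ)) * (ε z • (1 : Matrix (Fin N) (Fin N) ℂ)) = 1 := by
      rw [Matrix.smul_mul, Matrix.mul_smul, Matrix.one_mul, smul_smul, hε, one_smul]
    calc ρ (g z)⁻¹ = ρ (g z)⁻¹ * (ρ (g z) * (ε z • (1 : Matrix (Fin N) (Fin N) ℂ))) := by
          rw [hg, h2, Matrix.mul_one]
      _ = ε z • (1 : Matrix (Fin N) (Fin N) ℂ) := by rw [← Matrix.mul_assoc, h1, Matrix.one_mul]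
  have hlink : ∀ (z : TorusSite 4 L) (μ : Fin 4),
      ρ (gaugeTransform g U (z, μ)) = (ε z * ε (Site.shift z μ)) • ρ (U (z, μ)) := by
    intro z μ
    simp only [gaugeTransform, map_mul, hg, hginv, Matrix.smul_mul, Matrix.mul_smul,
      Matrix.one_mul, Matrix.mul_one, smul_smul, mul_comm (ε (Site.shift z μ))]
  have hlinkinv : ∀ (z : TorusSite 4 L) (μ : Fin 4),
      ρ (gaugeTransform g U (z, μ))⁻¹ = (ε z * ε (Site.shift z μ)) • ρ (U (z, μ))⁻¹ := by
    intro z μ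
    have : (gaugeTransform g U (z, μ))⁻¹ = g (Site.shift z μ) * ((U (z, μ))⁻¹ * (g z)⁻¹) := by
      simp only [gaugeTransform, _root_.mul_inv_rev, inv_inv, mul_assoc]
    rw [this, map_mul, map_mul, hg, hginv, Matrix.smul_mul, Matrix.mul_smul, Matrix.one_mul,
      Matrix.mul_one, smul_smul, mul_comm (ε (Site.shift z μ))]
  simp only [wilsonDiracG, Matrix.of_apply, hlink, hlinkinv, Matrix.smul_apply, smul_eq_mul]
  refine entry_scale_eq _ _ _ _ _ ?_ (fun μ => ?_)
  · by_cases h : ((x, a, α) : TorusSite 4 L × Fin N × Fin 4) = (y, b, β)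
    · simp only [Prod.mk.injEq] at h
      obtain ⟨rfl, rfl, rfl⟩ := h
      rw [if_pos rfl, hε, one_mul]
    · rw [if_neg h, mul_zero]
  · rw [mul_add]
    congr 1
    · split_ifs with h
      · subst h; ring
      · rw [mul_zero]
    · split_ifs with h
      · subst h; ring
      · rw [mul_zero]

end General

/-! ## The determinant in the chiral basis -/

/-- **The determinant is basis independent**:
`det (wilsonDiracG ρ chiralGamma U m r) = det (wilsonDirac ρ U m r)`. -/
theorem det_wilsonDiracG_chiral {L N : ℕ} [NeZero L] {G : Type*} [Group G]
    (ρ : G →* Matrix (Fin N) (Fin N) ℂ) (U : GaugeConfig 4 L G) (m r : ℝ) :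
    (wilsonDiracG ρ chiralGamma U m r).det = (wilsonDirac ρ U m r).det := by
  have h1 : spinorLift (L := L) (N := N) uSpin * spinorLift uInv = 1 := by
    rw [spinorLift_mul_spinorLift, uSpin_mul_uInv]
    simp [spinorLift]
  have key : wilsonDiracG ρ chiralGamma U m r =
      spinorLift uSpin * wilsonDirac ρ U m r * spinorLift uInv := by
    rw [wilsonDirac_eq_wilsonDiracG, spinorLift_mul_wilsonDiracG ρ uSpin_mul_gamma, Matrix.mul_assoc,
      h1, Matrix.mul_one]
  rw [key, det_mul, det_mul, mul_comm (det _) (det (wilsonDirac ρ U m r)), mul_assoc, ← det_mul, h1,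
    det_one, mul_one]

end Summit.QuantumFields.QCD.Theorems.UnquenchedChessboardBoundLine

end
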